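import Summits.BirchSwinnertonDyer.BirchSwinnertonDyer.Theorems.PrintX8VSCKatoLengthFormOfBSDpRankZero
import Literature.NumberTheory.EllipticCurves.Sprung2012.FineSelmerLeSharpFlatSelmerProofs
import Literature.NumberTheory.EllipticCurves.Sprung2012.SharpFlatSelmerTorsionOfContragredientSequenceProofs
import Literature.NumberTheory.EllipticCurves.Kato2004.IwasawaInvolutionTwistProofs
import Literature.NumberTheory.EllipticCurves.Kato2004.MainConjectureSkeletonProofs
import Literature.NumberTheory.EllipticCurves.KatoFineSelmerDualProofs
import HarnessLib

/-!
# Corner X8 (`p = 3`, `a₃ = ±3`), analytic rank `0`, ANY image, PRINT keying: COLOUR EXCHANGE (Sprung's Prop. 7.19 in print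
# keying, through Kato's 12.10 in length form) and the FULL rank-zero converse — `BSD(E,3)` at the pair ⟹ the ENTIRE body of
# item 23742 `PrintX8VSC.SharpFlatMainConjectureX8Contra` at `(W, 3)`: Main Conj. 7.21 for EVERY colour with `L^• ≠ 0` and
# every `γ⁻¹`-keyed dual; class-wide, the rank-zero half of the leaf ⟺ 23742 restricted to `r_an = 0`
# (cell `bsd-print-x8`, prover seat p2 gen 7, third file of the converse series p681647 / p682354; route `PrintX8VSC`;
# `--supports` 23742 as a helper; ROUTE-INDEPENDENT; closes nothing)

PARTITION: per-pair and class theorems CONDITIONAL on PUBLISHED named facts only; closes NONE; 0 census cells move; BSD, K′,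
C′, MC′ (as filed, `r_an ≤ 1`) and the leaf X8 are NOT proved by any of this.

## What this file adds

p681647 (§1) gave Main Conj. 7.21′ at a rank-zero pair with `BSDp W 3` only for colours of UNIT CONTENT (the THEOREM-B colour
`•₀`, where gen 4's integral Kato divisibility is image-free); p682354 turned it into Kato's Conj. 12.10 in length form
`ℓ_𝔭(𝐇¹ ⧸ C₀.Z) = ℓ_𝔭 Y′.X` for a package `C₀` of colour `•₀`. Kato's statement does not see the colour, so Sprung's Prop.
7.19 read for the OTHER colour `•` (with `L^• ≠ 0`, possibly of non-unit content) gives Main Conj. 7.21′ for `•` too —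
COLOUR EXCHANGE, the «Kato ⟹ 7.21» direction p3 g7 left to «only on ask»; what it needs beyond the four-term identity
`ℓ_𝔭 D.X + ℓ_𝔭(𝐇¹ ⧸ C.Z) = ℓ_𝔭 Y′.X + ℓ_𝔭 Λ/(G)` (LEAD g6, `SharpFlatColemanKatoDataContra.lengthAt_add_eq`) on the JOINT
packages (`C₀.Z = C.Z`, the held print `thm714seq_sharpFlatColemanKato_zetaJoint_contra` = Sprung Thm. 7.14 (3) with
(7.4), conjunct (iii) of pack 23734) is `ℓ_𝔭 Y′.X ≠ ⊤` for ONE print-keyed fine datum — supplied INPUT-FREE: the fine dual is a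
quotient of the ♯/♭ dual (`Sel₀ ≤ Sel^{•₀}`, `SharpFlatSelmerDualData.fineDual_isTorsion/_moduleFinite`, w3 g9), Thm. 7.14
makes `X^{•₀}` f.g. torsion, and the `ι`-twist carries both properties to key `γ⁻¹`
(`Kato2004.fineSelmerDualData_exists_involTwist`, `fineSelmerDualData_isTorsion_inv_iff`). No Kato 12.4, no Matar.

* §1 `X8.sharpFlatCharIdeal_eq_contra_exchange_of_bsdp_of_analyticRank_eq_zero` — PER PAIR, ANY image: X8 ∧ `r_an = 0` ∧
  `BSDp W 3`; frame, newform/period/Sprung pair; a unit-content colour `•₀`; a colour `•` with `L^• ≠ 0`; a Kato datum `I` with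
  packages `C₀` (colour `•₀`) and `C` (colour `•`), `C₀.Z = C.Z`; ANY `γ⁻¹`-keyed dual `D` of `Sel^•(E/ℚ_∞)` ⟹ `D.X` torsion and
  `char D.X = (G)`, `ι G = ϖ·ι L^•` — Main Conj. 7.21′ for `•`.
* §2 `X8.sharpFlatMainConjectureContra_at_of_bsdp_of_analyticRank_eq_zero` — **the FULL per-pair converse**: X8 ∧ `r_an = 0` ∧
  `BSDp W 3` ⟹ the body of item 23742 at `(W, 3)` VERBATIM after its `ClassX8 W p → W.analyticRank ≤ 1 →` prefix (every colour
  with `L^• ≠ 0`, every frame, every `D`), under the three `T₃W`-instance binders the cruxes K′/C′ also carry; the joint packages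
  come from the held print `hJc`, the Kato datum from `Kato2004.nonempty_iwasawaH1Data_holds` (PROVED), `•₀` from THEOREM B.
* §3 `X8.bsdp_rankZero_iff_sharpFlatMainConjectureContra_rankZero` — CLASS EQUIVALENCE: (`BSDp` at every rank-zero X8 pair)
  ⟺ (item 23742's body with `W.analyticRank = 0` for `≤ 1`), both sides under the instance binders; «⟸» by w3's road p674964 at
  the THEOREM-B colour. Displayed facts: h714, h716c, hCKc, hJc, h59 (tree theorem), h3, hGZK, hmod (+ hmodf, h22 for «⟸»).

READING. On X8 ∩ {r_an = 0} the leaf `WAllCornerX8` and the route's main-conjecture node 23742 say THE SAME THING modulo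
published print (23744 closed: 23742 ⟹ r0 p-part; this file: r0 p-part ⟹ 23742↾r0). The research cruxes K′/C′ therefore carry,
on the rank-zero locus, exactly the content of BSD₃ at the 88 non-unit rank-zero census cells (82 surj + 6 `C_ns⁺(3)`) and the
class behind them; at the 54 unit cells 23742↾{pair} is a theorem (all colours). Rank one is not touched (g5/g6 notes).

HONEST STATUS. Conditional on displayed PUBLISHED named facts; THEOREM B, Wuthrich L20, `nonempty_iwasawaH1Data_holds`, Sprung
2017 Thm. 1.12, Thm. 2.2 enter as kernel theorems. beyond-print theorem: YES (modest; as p681647, now for both colours).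
References: [Sprung2012] Def. 6.1, Def. 7.11/7.13, Thm. 7.14 (3), Thm. 7.16, Prop. 7.19, Main Conj. 7.21 (pp. 1495–1505);
[Kato2004Asterisque] §12.2, Conj. 12.10, Thm. 12.5/12.6, §13.8, §17.13; [Sprung2024] §5.2; [GreenbergLNM1716] §1 (p. 60), §4 (p. 103);
[Greenberg1989] §0; [SkinnerUrban2014] §3.1.6; [Washington1997] §13.2; [Miller2011LMS] Def. 1.1; tree: p681647, p682354, p677031, p674964.
-/

set_option autoImplicit false
-- justification: the mandated namespace `Summit.BirchSwinnertonDyer.BirchSwinnertonDyer.Theorems` repeats a segment (D-0017).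
set_option linter.dupNamespace false

noncomputable section
open scoped Classical NumberField MatrixGroups ModularForm

open NumberField IsDedekindDomain WeierstrassCurve CongruenceSubgroup Field
  Literature.NumberTheory.EllipticCurves Literature.NumberTheory.EllipticCurves.ModularForms
  Literature.NumberTheory.EllipticCurves.Rank1Residual
  Literature.NumberTheory.EllipticCurves.Rank1Residual.Typed
  Literature.NumberTheory.EllipticCurves.Sprung2017 Literature.NumberTheory.EllipticCurves.Sprung2012
  Literature.NumberTheory.EllipticCurves.Sprung2024
  Literature.NumberTheory.EllipticCurves.GreenbergVatsal2000
  Literature.NumberTheory.EllipticCurves.ZpExtension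
  Literature.NumberTheory.EllipticCurves.IwasawaAlgebra
  Literature.NumberTheory.EllipticCurves.Kato2004
  Summit.BirchSwinnertonDyer.BirchSwinnertonDyer.Theorems
  Summit.BirchSwinnertonDyer.Rank1Residual.Supersingular

namespace Summit.BirchSwinnertonDyer.BirchSwinnertonDyer.Theorems.X8KatoConverseContraExchange

section PerPair

variable (W : WeierstrassCurve ℚ) [W.IsElliptic] [W.IsGloballyMinimal] (p : ℕ) [Fact p.Prime]
  [ContinuousSMul ℤ_[p] (W.tateModule p)] [Module.Free ℤ_[p] (W.tateModule p)] [Module.Finite ℤ_[p] (W.tateModule p)]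

/-! ### §1 COLOUR EXCHANGE at a rank-zero pair with `BSD(E,3)`: Main Conj. 7.21′ passes from `•₀` to every `•` with `L^• ≠ 0` -/

/-- **X8 ∧ `r_an = 0` ∧ `BSD(E,3)`, ANY image, PRINT keying: Main Conj. 7.21′ for EVERY colour `•` with `L^• ≠ 0`, given the
JOINT contragredient packages.** Frame `(κ, γ, v, g, cneg, c)`, newform `f` with `ϖ·Ω_E = Ω⁺_f`, Sprung pair; `•₀` of UNIT
CONTENT, `•` with `L^• ≠ 0`; a Kato datum `I` with packages `C₀` of colour `•₀` and `C` of colour `•` on the same zeta line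
(`C₀.Z = C.Z`); `D` ANY `γ⁻¹`-keyed dual of `Sel^•(E/ℚ_∞)`. Then `D.X` is torsion and `char D.X = (G)` with `ι G = ϖ·ι L^•`.
Chain: Kato 12.10 in length form at a key-`γ⁻¹` fine datum `Y₁` (p682354 §1, colour `•₀`); `Y₁ := (Y₀)^ι` for a key-`γ` fine
datum `Y₀`, which is a QUOTIENT of the key-`γ` dual `X^{•₀}` (`Sel₀ ≤ Sel^{•₀}`), hence f.g. torsion by Thm. 7.14 — so
`ℓ_𝔭 Y₁.X ≠ ⊤`; the four-term identity for `C` (`C₀.Z = C.Z`) then gives `ℓ_𝔭 D.X = ℓ_𝔭 Λ/(G)` at every height-one `𝔭`, i.e.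
`char D.X = (G)` (`Module.charIdeal_eq_of_lengthAt_eq`, `charIdeal_quotient_span_singleton`). PER PAIR; conditional; closes nothing.
[cite: Sprung2012, Def. 7.13, Thm. 7.14 (3) (p. 1504), Prop. 7.19 and Main Conj. 7.21 (p. 1505)]
[cite: Kato2004Asterisque, Conj. 12.10 (p. 224) and §17.13 (p. 280)] [cite: GreenbergLNM1716, §1 (p. 60) and §4 (p. 103)]
[cite: Washington1997, §13.2] [cite: Sprung2024, §5.2 Lemmas 5.5–5.9] -/
theorem X8.sharpFlatCharIdeal_eq_contra_exchange_of_bsdp_of_analyticRank_eq_zero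
    (h714 : thm714_sharpFlatSelmerDual_finite_torsion)
    (h716c : thm716_sharpFlatCharIdeal_divisibility_contra)
    (hCKc : thm714seq_sharpFlatColemanKato_zeta_contra)
    (h59 : lem59AllN_sharpFlatCharValue_rankZero)
    (h3 : realPeriodRat_eq_unit_mul_plusPeriod_three)
    (hGZK : rank_eq_analyticRank_of_analyticRank_le_one) (hmod : hasEntireLFunction_rat)
    (hX : ClassX8 W p) (h0 : W.analyticRank = 0) (hB : BSDp W p)
    {κ : ZpExtension ℚ p} {γ : absoluteGaloisGroup ℚ} (hκ : κ.IsCyclotomic)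
    (hγ : κ.IsTopGenerator γ) (hγ' : IsCyclotomicVariable p γ)
    {v : HeightOneSpectrum (𝓞 ℚ)} (hv : (p : 𝓞 ℚ) ∈ v.asIdeal)
    {g : absoluteGaloisGroup (v.adicCompletion ℚ)}
    (hg : κ.IsTopGenerator (resGalOfEmb (closureEmb (K := ℚ) (v.adicCompletion ℚ)) g))
    {cneg : localPoints W (v.adicCompletion ℚ)} {c : ℕ → localPoints W (v.adicCompletion ℚ)}
    (hc : IsHondaSystem κ (closureEmb (K := ℚ) (v.adicCompletion ℚ)) W (W.frobeniusTrace p) g cneg c)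
    {N : ℕ} [NeZero N] {f : CuspForm (Gamma0 N) 2} (hf : IsNewformOf W f)
    {ϖ : ℚ} (hϖ : (ϖ : ℝ) * W.realPeriodRat = plusPeriod f)
    {Lsharp Lflat : IwasawaAlgebra p} (hSP : IsSprungPair f p (W.frobeniusTrace p) Lsharp Lflat)
    (col₀ : Chroma) (hu : HasUnitContent (chromaticL col₀ Lsharp Lflat))
    (col : Chroma) (hcol : chromaticL col Lsharp Lflat ≠ 0)
    (I : IwasawaH1Data W p κ γ)
    (C₀ : SharpFlatColemanKatoDataContra W p f ϖ κ γ (closureEmb (K := ℚ) (v.adicCompletion ℚ))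
      (W.frobeniusTrace p) g c col₀ I)
    (C : SharpFlatColemanKatoDataContra W p f ϖ κ γ (closureEmb (K := ℚ) (v.adicCompletion ℚ))
      (W.frobeniusTrace p) g c col I)
    (hZ : C₀.Z = C.Z)
    (D : SharpFlatSelmerDualData W κ γ⁻¹ (closureEmb (K := ℚ) (v.adicCompletion ℚ))
      (W.frobeniusTrace p) g c col) :
    Module.IsTorsion (IwasawaAlgebra p) D.X ∧ ∃ gen : IwasawaAlgebra p, D.charIdeal = Ideal.span {gen} ∧
      iwasawaToPowerSeries p gen =
        PowerSeries.C (ϖ : ℚ_[p]) * iwasawaToPowerSeries p (chromaticL col Lsharp Lflat) := by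
  have hp3 : p = 3 := hX.1
  subst hp3
  have hp2 : (3 : ℕ) ≠ 2 := by decide
  have hgood : W.HasGoodReductionAtPrime 3 := hX.2.1.1
  have hdvd : ((3 : ℕ) : ℤ) ∣ W.frobeniusTrace 3 := hX.2.1.2
  have hirr : W.HasIrreducibleModPGaloisRep 3 := ClassX8.irr W 3 hX
  have hcol₀ : chromaticL col₀ Lsharp Lflat ≠ 0 :=
    Summit.BirchSwinnertonDyer.Rank1Residual.X11a.ne_zero_of_hasUnitContent hu
  -- Thm. 7.14 AT KEY `γ` for colour `•` (tree-keyed dual), transported to the print-keyed `D`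
  let D₀ := sharpFlatSelmerDualData W κ (closureEmb (K := ℚ) (v.adicCompletion ℚ))
    (W.frobeniusTrace 3) g c col hγ
  obtain ⟨hfin₀, htor₀⟩ :=
    h714 W 3 hp2 hgood hdvd f hf κ γ hκ hγ hγ' v hv g hg cneg c hc col Lsharp Lflat hSP hcol D₀
  haveI := hfin₀
  haveI : Module.Finite (IwasawaAlgebra 3) D.X := (sharpFlatSelmerDualData_finite_inv_iff D₀ D).1 hfin₀
  have htor : Module.IsTorsion (IwasawaAlgebra 3) D.X := (sharpFlatSelmerDualData_isTorsion_inv_iff D₀ D).1 htor₀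
  refine ⟨htor, ?_⟩
  -- a key-`γ` fine datum `Y₀` is a QUOTIENT of the key-`γ` dual of colour `•₀` (f.g. torsion by Thm. 7.14): f.g. torsion
  let E₀ := sharpFlatSelmerDualData W κ (closureEmb (K := ℚ) (v.adicCompletion ℚ))
    (W.frobeniusTrace 3) g c col₀ hγ
  obtain ⟨hfinE, htorE⟩ :=
    h714 W 3 hp2 hgood hdvd f hf κ γ hκ hγ hγ' v hv g hg cneg c hc col₀ Lsharp Lflat hSP hcol₀ E₀
  haveI := hfinE
  obtain ⟨Y₀⟩ := W.nonempty_fineSelmerDualData κ hγ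
  haveI : Module.Finite (IwasawaAlgebra 3) Y₀.X := E₀.fineDual_moduleFinite hγ Y₀
  have hY₀t : Module.IsTorsion (IwasawaAlgebra 3) Y₀.X := E₀.fineDual_isTorsion hγ Y₀ htorE
  -- its `ι`-twist `Y₁` is a key-`γ⁻¹` fine datum, still f.g. torsion, so `ℓ_𝔭 Y₁.X ≠ ⊤`
  obtain ⟨Y₁, e, he, -⟩ := Kato2004.fineSelmerDualData_exists_involTwist (mul_inv_cancel γ) Y₀
  haveI : Module.Finite (IwasawaAlgebra 3) Y₁.X := Kato2004.finite_of_involSemilinear e he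
  have hY₁t : Module.IsTorsion (IwasawaAlgebra 3) Y₁.X := (fineSelmerDualData_isTorsion_inv_iff Y₀ Y₁).mp hY₀t
  -- the Néron-normalised generator `G = ϖ·L^•` (`ϖ ∈ ℤ₃ˣ`)
  have hϖ1 : ‖(ϖ : ℚ_[3])‖ = 1 := X8_norm_periodRatio_eq_one h3 W 3 hX hf hϖ
  obtain ⟨-, hιG⟩ := span_C_units_mul_eq (PadicInt.mkUnits hϖ1) (chromaticL col Lsharp Lflat)
  set G : IwasawaAlgebra 3 := PowerSeries.C ((PadicInt.mkUnits hϖ1 : ℤ_[3]ˣ) : ℤ_[3]) * chromaticL col Lsharp Lflat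
    with hG_def
  have hG : iwasawaToPowerSeries 3 G =
      PowerSeries.C ((ϖ : ℚ) : ℚ_[3]) * iwasawaToPowerSeries 3 (chromaticL col Lsharp Lflat) := by
    rw [hιG, PadicInt.mkUnits_eq]
  have hG0 : G ≠ 0 := mul_ne_zero ((PadicInt.mkUnits hϖ1).isUnit.map PowerSeries.C).ne_zero hcol
  -- lengths of `D.X` and `Λ/(G)` agree at every height-one prime
  have hlen : ∀ 𝔭 : PrimeSpectrum (IwasawaAlgebra 3), 𝔭.asIdeal.height = 1 →
      Module.lengthAt (IwasawaAlgebra 3) D.X 𝔭 =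
        Module.lengthAt (IwasawaAlgebra 3) (IwasawaAlgebra 3 ⧸ Ideal.span {G}) 𝔭 := by
    intro 𝔭 h𝔭
    -- Kato 12.10 in length form at `Y₁` from colour `•₀` (p682354 §1), read on the common zeta line
    have hK : Module.lengthAt (IwasawaAlgebra 3) (I.H ⧸ C.Z) 𝔭 = Module.lengthAt (IwasawaAlgebra 3) Y₁.X 𝔭 := by
      rw [← hZ]
      exact X8KatoConverseContraLength.X8.katoFineLengthAt_eq_of_bsdp_of_hasUnitContent_of_analyticRank_eq_zero W 3 h714
        h716c hCKc h59 h3 hGZK hmod hX h0 hB hκ hγ hγ' hv hg hc hf hϖ hSP col₀ hu I C₀ Y₁ 𝔭 h𝔭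
    -- four-term identity for colour `•`
    have hFT := C.lengthAt_add_eq W 3 hirr hSP hcol hG D Y₁ 𝔭 h𝔭
    rw [hK, add_comm (Module.lengthAt (IwasawaAlgebra 3) D.X 𝔭)] at hFT
    exact WithTop.add_left_cancel (IwasawaAlgebra.lengthAt_ne_top_of_isTorsion Y₁.X hY₁t 𝔭 h𝔭.le) hFT
  refine ⟨G, ?_, hG⟩
  exact (Module.charIdeal_eq_of_lengthAt_eq hlen).trans (Module.charIdeal_quotient_span_singleton hG0)

/-! ### §2 The FULL per-pair converse: `BSD(E,3)` at a rank-zero X8 pair ⟹ item 23742's body at `(W, 3)`, every colour -/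

/-- **X8 ∧ `r_an = 0` ∧ `BSD(E,3)`, ANY image, PRINT keying ⟹ Sprung's Main Conj. 7.21 for EVERY colour `•` with `L^• ≠ 0` and
EVERY `γ⁻¹`-keyed dual** — the body of `PrintX8VSC.SharpFlatMainConjectureX8Contra` (item 23742) at `(W, 3)` after its
`ClassX8 W p → W.analyticRank ≤ 1 →` prefix, token for token, under the `T₃W`-instance binders the cruxes K′/C′ carry. Inputs BY
NAME (published): h714, h716c, hCKc, the JOINT package print `hJc` (Sprung Thm. 7.14 (3) with (7.4), pack 23734 (iii)), h59 (tree
theorem), h3, hGZK, hmod; kernel theorems: THEOREM B (`ClassX8.oneColourMuAn`: a unit-content colour `•₀`), Kato's pinned `𝐇¹`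
(`Kato2004.nonempty_iwasawaH1Data_holds`), §1 (exchange `•₀ ↦ •` on the joint packages; `•₀ = •` included with `C₀ = C`).
PER PAIR; conditional; closes nothing. [cite: Sprung2012, Thm. 7.14 (3) (p. 1504), Prop. 7.19 and Main Conj. 7.21 (p. 1505)]
[cite: Kato2004Asterisque, §12.2 (12.2.1) (p. 220), Conj. 12.10 (p. 224)] [cite: GreenbergLNM1716, §4 (p. 103)]
[cite: Sprung2024, §5.2 Lemmas 5.5–5.9] [cite: Miller2011LMS, Def. 1.1] -/
theorem X8.sharpFlatMainConjectureContra_at_of_bsdp_of_analyticRank_eq_zero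
    (h714 : thm714_sharpFlatSelmerDual_finite_torsion)
    (h716c : thm716_sharpFlatCharIdeal_divisibility_contra)
    (hCKc : thm714seq_sharpFlatColemanKato_zeta_contra)
    (hJc : thm714seq_sharpFlatColemanKato_zetaJoint_contra)
    (h59 : lem59AllN_sharpFlatCharValue_rankZero)
    (h3 : realPeriodRat_eq_unit_mul_plusPeriod_three)
    (hGZK : rank_eq_analyticRank_of_analyticRank_le_one) (hmod : hasEntireLFunction_rat)
    (hX : ClassX8 W p) (h0 : W.analyticRank = 0) (hB : BSDp W p)
    (col : Chroma) (κ : ZpExtension ℚ p) (γ : absoluteGaloisGroup ℚ) (hκ : κ.IsCyclotomic)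
    (hγ : κ.IsTopGenerator γ) (hγ' : IsCyclotomicVariable p γ)
    (v : HeightOneSpectrum (𝓞 ℚ)) (hv : (p : 𝓞 ℚ) ∈ v.asIdeal)
    (g : absoluteGaloisGroup (v.adicCompletion ℚ))
    (hg : κ.IsTopGenerator (resGalOfEmb (closureEmb (K := ℚ) (v.adicCompletion ℚ)) g))
    (cneg : localPoints W (v.adicCompletion ℚ)) (c : ℕ → localPoints W (v.adicCompletion ℚ))
    (hc : IsHondaSystem κ (closureEmb (K := ℚ) (v.adicCompletion ℚ)) W (W.frobeniusTrace p) g cneg c)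
    (N : ℕ) (_hN : NeZero N) (f : CuspForm (Gamma0 N) 2) (ϖ : ℚ) (Lsharp Lflat : IwasawaAlgebra p)
    (hf : IsNewformOf W f) (hϖ : (ϖ : ℝ) * W.realPeriodRat = plusPeriod f)
    (hSP : IsSprungPair f p (W.frobeniusTrace p) Lsharp Lflat) (hcol : chromaticL col Lsharp Lflat ≠ 0)
    (D : SharpFlatSelmerDualData W κ γ⁻¹ (closureEmb (K := ℚ) (v.adicCompletion ℚ))
      (W.frobeniusTrace p) g c col) :
    Module.IsTorsion (IwasawaAlgebra p) D.X ∧ ∃ gen : IwasawaAlgebra p, D.charIdeal = Ideal.span {gen} ∧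
      iwasawaToPowerSeries p gen =
        PowerSeries.C (ϖ : ℚ_[p]) * iwasawaToPowerSeries p (chromaticL col Lsharp Lflat) := by
  have hp3 : p = 3 := hX.1
  subst hp3
  have hp2 : (3 : ℕ) ≠ 2 := by decide
  have hgood : W.HasGoodReductionAtPrime 3 := hX.2.1.1
  have hdvd : ((3 : ℕ) : ℤ) ∣ W.frobeniusTrace 3 := hX.2.1.2
  haveI : NeZero N := _hN
  -- THEOREM B: a unit-content colour `•₀`; Kato's pinned `𝐇¹`; the JOINT contragredient packages (held print)
  obtain ⟨col₀, -, -, hu, -⟩ :=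
    PrintX8VSOneColourMuAnX8.ClassX8.oneColourMuAn W 3 hX N _hN f Lsharp Lflat hf hSP
  obtain ⟨I⟩ := Kato2004.nonempty_iwasawaH1Data_holds W 3 κ γ hκ hγ
  obtain ⟨Cs, Cf, hZ⟩ := hJc W 3 f ϖ κ γ hp2 hgood hdvd hf hϖ hκ hγ hγ' v hv g hg cneg c hc I
  -- exchange `•₀ ↦ •` on the common zeta line (four cases)
  cases col₀ with
  | sharp =>
    cases col with
    | sharp =>
      exact X8.sharpFlatCharIdeal_eq_contra_exchange_of_bsdp_of_analyticRank_eq_zero W 3 h714 h716c hCKc h59 h3 hGZK hmod hX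
        h0 hB hκ hγ hγ' hv hg hc hf hϖ hSP Chroma.sharp hu Chroma.sharp hcol I Cs Cs rfl D
    | flat =>
      exact X8.sharpFlatCharIdeal_eq_contra_exchange_of_bsdp_of_analyticRank_eq_zero W 3 h714 h716c hCKc h59 h3 hGZK hmod hX
        h0 hB hκ hγ hγ' hv hg hc hf hϖ hSP Chroma.sharp hu Chroma.flat hcol I Cs Cf hZ D
  | flat =>
    cases col with
    | sharp =>
      exact X8.sharpFlatCharIdeal_eq_contra_exchange_of_bsdp_of_analyticRank_eq_zero W 3 h714 h716c hCKc h59 h3 hGZK hmod hX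
        h0 hB hκ hγ hγ' hv hg hc hf hϖ hSP Chroma.flat hu Chroma.sharp hcol I Cf Cs hZ.symm D
    | flat =>
      exact X8.sharpFlatCharIdeal_eq_contra_exchange_of_bsdp_of_analyticRank_eq_zero W 3 h714 h716c hCKc h59 h3 hGZK hmod hX
        h0 hB hκ hγ hγ' hv hg hc hf hϖ hSP Chroma.flat hu Chroma.flat hcol I Cf Cf rfl D

end PerPair

/-! ### §3 CLASS EQUIVALENCE on X8 ∩ {r_an = 0}: the rank-zero half of the leaf ⟺ item 23742 restricted to `r_an = 0` -/

/-- **CLASS EQUIVALENCE.** Modulo the displayed published facts (h714, h716c, hCKc, hJc, h59, h3, hGZK, hmod; hmodf, h22 for «⟸»):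
`BSDp W 3` at every rank-zero X8 pair (under the `T₃W`-instance binders) ⟺ the body of item 23742
`PrintX8VSC.SharpFlatMainConjectureX8Contra` with `W.analyticRank = 0` in place of `≤ 1` (same binders) — EVERY colour with
`L^• ≠ 0`, every frame, every `γ⁻¹`-keyed dual. «⟹» is §2 pair by pair; «⟸»: at a pair take the newform (`hmodf`), Sprung's pair
(Thm. 1.12), the THEOREM-B colour, the cyclotomic/Honda frame (`h22`, Thm. 2.2), `ϖ = u⁻¹` (`h3`), a print-keyed dual
(`nonempty_sharpFlatSelmerDualData_rat`), and w3's road `X8.bsdp_of_charIdeal_eq_contra_of_analyticRank_eq_zero` (p674964).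
So on the rank-zero locus the leaf `WAllCornerX8` and the node 23742 are the SAME statement modulo print. Conditional; closes nothing.
[cite: Sprung2012, Thm. 2.2, Prop. 6.14, Thm. 7.14 (3), Thm. 7.16, Prop. 7.19, Main Conj. 7.21 (pp. 1487–1505)]
[cite: Sprung2017, Thm. 1.12] [cite: Sprung2024, §5.2 Lemmas 5.5–5.9] [cite: GreenbergLNM1716, §4 (p. 103)] [cite: Miller2011LMS, Def. 1.1] -/
theorem X8.bsdp_rankZero_iff_sharpFlatMainConjectureContra_rankZero
    (hmodf : exists_isNewformOf) (h22 : thm22_exists_isHondaSystem)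
    (h714 : thm714_sharpFlatSelmerDual_finite_torsion)
    (h716c : thm716_sharpFlatCharIdeal_divisibility_contra)
    (hCKc : thm714seq_sharpFlatColemanKato_zeta_contra)
    (hJc : thm714seq_sharpFlatColemanKato_zetaJoint_contra)
    (h59 : lem59AllN_sharpFlatCharValue_rankZero)
    (h3 : realPeriodRat_eq_unit_mul_plusPeriod_three)
    (hGZK : rank_eq_analyticRank_of_analyticRank_le_one) (hmod : hasEntireLFunction_rat) :
    (∀ (W : WeierstrassCurve ℚ) [W.IsElliptic] [W.IsGloballyMinimal] (p : ℕ) [Fact p.Prime]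
      [ContinuousSMul ℤ_[p] (W.tateModule p)] [Module.Free ℤ_[p] (W.tateModule p)]
      [Module.Finite ℤ_[p] (W.tateModule p)], ClassX8 W p → W.analyticRank = 0 → BSDp W p) ↔
    ∀ (W : WeierstrassCurve ℚ) [W.IsElliptic] [W.IsGloballyMinimal] (p : ℕ) [Fact p.Prime]
      [ContinuousSMul ℤ_[p] (W.tateModule p)] [Module.Free ℤ_[p] (W.tateModule p)]
      [Module.Finite ℤ_[p] (W.tateModule p)], ClassX8 W p → W.analyticRank = 0 →
      ∀ (col : Chroma) (κ : ZpExtension ℚ p) (γ : absoluteGaloisGroup ℚ),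
      κ.IsCyclotomic → κ.IsTopGenerator γ → IsCyclotomicVariable p γ →
      ∀ (v : HeightOneSpectrum (𝓞 ℚ)), (p : 𝓞 ℚ) ∈ v.asIdeal →
      ∀ (g : absoluteGaloisGroup (v.adicCompletion ℚ)),
      κ.IsTopGenerator (resGalOfEmb (closureEmb (K := ℚ) (v.adicCompletion ℚ)) g) →
      ∀ (cneg : localPoints W (v.adicCompletion ℚ)) (c : ℕ → localPoints W (v.adicCompletion ℚ)),
      IsHondaSystem κ (closureEmb (K := ℚ) (v.adicCompletion ℚ)) W (W.frobeniusTrace p) g cneg c →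
      ∀ (N : ℕ) (_ : NeZero N) (f : CuspForm (Gamma0 N) 2) (ϖ : ℚ) (Lsharp Lflat : IwasawaAlgebra p),
      IsNewformOf W f → (ϖ : ℝ) * W.realPeriodRat = plusPeriod f →
      IsSprungPair f p (W.frobeniusTrace p) Lsharp Lflat → chromaticL col Lsharp Lflat ≠ 0 →
      ∀ (D : SharpFlatSelmerDualData W κ γ⁻¹ (closureEmb (K := ℚ) (v.adicCompletion ℚ))
        (W.frobeniusTrace p) g c col),
      Module.IsTorsion (IwasawaAlgebra p) D.X ∧ ∃ gen : IwasawaAlgebra p, D.charIdeal = Ideal.span {gen} ∧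
        iwasawaToPowerSeries p gen =
          PowerSeries.C (ϖ : ℚ_[p]) * iwasawaToPowerSeries p (chromaticL col Lsharp Lflat) := by
  refine ⟨fun hBSD W _ _ p _ _ _ _ hX h0 col κ γ hκ hγ hγ' v hv g hg cneg c hc N hN f ϖ Ls Lf hf hϖ hSP hcol D ↦
    X8.sharpFlatMainConjectureContra_at_of_bsdp_of_analyticRank_eq_zero W p h714 h716c hCKc hJc h59 h3 hGZK hmod hX h0
      (hBSD W p hX h0) col κ γ hκ hγ hγ' v hv g hg cneg c hc N hN f ϖ Ls Lf hf hϖ hSP hcol D,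
    fun hMC W _ _ p _ _ _ _ hX h0 ↦ ?_⟩
  have hp3 : p = 3 := hX.1
  subst hp3
  have hp2 : (3 : ℕ) ≠ 2 := by decide
  have hgood : W.HasGoodReductionAtPrime 3 := hX.2.1.1
  have hdvd : ((3 : ℕ) : ℤ) ∣ W.frobeniusTrace 3 := hX.2.1.2
  have hirr : W.HasIrreducibleModPGaloisRep 3 := ClassX8.irr W 3 hX
  haveI : NeZero (W.conductorNorm ℤ) := ⟨(W.conductorNorm_pos_holds).ne'⟩
  obtain ⟨f, hf⟩ := hmodf W
  obtain ⟨Lsharp, Lflat, hSP⟩ :=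
    thm112_exists_isSprungPair_holds (W := W) (f := f) (p := 3) hp2 hf hgood hdvd
  obtain ⟨col, hcol, -, -, -⟩ :=
    PrintX8VSOneColourMuAnX8.ClassX8.oneColourMuAn W 3 hX _ inferInstance f Lsharp Lflat hf hSP
  obtain ⟨κ, hκ, γ, hγ, hγ'⟩ := exists_isCyclotomic_isTopGenerator_isCyclotomicVariable_holds 3
  obtain ⟨v, hv⟩ :=
    Literature.NumberTheory.NumberFields.RingOfIntegers.exists_heightOneSpectrum_natCast_mem ℚ
      (p := 3) (by norm_num)
  obtain ⟨g, hg⟩ := hκ.exists_isTopGenerator_resGalOfEmb_adicCompletion v hv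
  obtain ⟨cneg, c, hc⟩ := h22 W 3 hp2 hgood hdvd κ γ hκ hγ hγ' v hv g hg
  obtain ⟨u, hu1, hΩ⟩ := h3 W hgood hirr f hf
  have hu0 : (u : ℝ) ≠ 0 := by
    intro h
    have h0' : u = 0 := by exact_mod_cast h
    rw [h0'] at hu1
    simp at hu1
  have hϖ : ((u⁻¹ : ℚ) : ℝ) * W.realPeriodRat = plusPeriod f := by
    rw [hΩ, Rat.cast_inv, ← mul_assoc, inv_mul_cancel₀ hu0, one_mul]
  obtain ⟨D⟩ := nonempty_sharpFlatSelmerDualData_rat W κ γ⁻¹ v g c col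
  obtain ⟨-, gen, hchar, hι⟩ :=
    hMC W 3 hX h0 col κ γ hκ hγ hγ' v hv g hg cneg c hc _ inferInstance f u⁻¹ Lsharp Lflat hf hϖ hSP hcol D
  exact X8MainConjectureRoadContra.X8.bsdp_of_charIdeal_eq_contra_of_analyticRank_eq_zero h714 h59 h3 hGZK hmod W 3
    hX h0 hκ hγ hγ' hv hg hc hf hϖ hSP col hcol D gen hchar hι

end Summit.BirchSwinnertonDyer.BirchSwinnertonDyer.Theorems.X8KatoConverseContraExchange

end
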